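import Literature.RepresentationTheory.Semisimple.Semisimplification
import Literature.RepresentationTheory.Semisimple.BrauerNesbitt
import Mathlib.LinearAlgebra.Charpoly.ToMatrix
import HarnessLib

/-!
# Irreducibility is detected by characteristic polynomials

Topic `Literature/RepresentationTheory/Semisimple`.  Three elementary facts about irreducibility
of representations of a group `G` over a field `k` (any characteristic), all PROVED, no
definitions:

* `Representation.isIrreducible_of_isIrreducible_comp` — if the restriction `ρ ∘ f` of `ρ` along
  a homomorphism `f : H → G` is irreducible, so is `ρ` (a `G`-stable subspace is `H`-stable);
* `Representation.not_isIrreducible_prod` — a direct sum `ρ ⊕ σ` of two representations on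
  non-zero spaces is reducible (`V ⊕ 0` is a proper non-zero subrepresentation);
* `not_isIrreducible_of_charpoly_eq_mul`, `isIrreducible_of_charpoly_eq` — **irreducibility of a
  matrix representation `σ : G → GL_n(k)` only depends on the characteristic polynomials
  `det(X - σ(g))`**: if they factor as `det(X - A(g)) · det(X - D(g))` for homomorphisms
  `A : G → GL_m(k)`, `D : G → GL_p(k)` with `m, p > 0`, then `σ` is reducible; hence if `τ` has
  the characteristic polynomials of an irreducible `σ`, then `τ` is irreducible.  Proof:
  semisimplify `A` and `D` (`exists_semisimplification`, Curtis–Reiner I §16B); if `σ` were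
  irreducible it would be semisimple with the characteristic polynomials of the semisimple
  `A^{ss} ⊕ D^{ss}`, hence equivalent to it by the Brauer–Nesbitt theorem over an arbitrary field
  (Bourbaki, *Algèbre* VIII § 20 n° 6, Thm. 2, Cor. 1; the tree's
  `Representation.nonempty_equiv_of_charpoly_eq`), contradicting `not_isIrreducible_prod`.
  This is the form in which Brauer–Nesbitt is used for residual Galois representations
  ("`ρ̄^{ss}` irreducible ⇒ `ρ̄` irreducible ⇒ `ρ` irreducible", Darmon–Diamond–Taylor 1995, §2.1).

Mathlib (this pin) has `Representation.IsIrreducible`, `Representation.prod`,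
`LinearMap.charpoly_prodMap`, but none of the three statements (grep `IsIrreducible` in
`Mathlib/RepresentationTheory`: Schur-type lemmas only).

## References

* N. Bourbaki, *Algèbre*, Ch. VIII (2012), § 20 n° 6, Thm. 2, Cor. 1 (p. 378).
  [BourbakiAlgebreVIII2012]
* C. W. Curtis, I. Reiner, *Methods of Representation Theory* I, Wiley (1981), §16B.
* H. Darmon, F. Diamond, R. Taylor, *Fermat's Last Theorem*, CDM 1995, §2.1.
  [DarmonDiamondTaylor1995]
-/

noncomputable section

open scoped MatrixGroups

open Matrix Module

namespace Literature.RepresentationTheory.Semisimple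

universe u v

variable {k : Type u} [Field k] {G : Type v} [Group G]

/-! ### Restriction and direct sums -/

/-- **An irreducible restriction forces irreducibility.**  If `f : H → G` is a homomorphism and
the restriction `ρ ∘ f` is irreducible, then `ρ` is irreducible: every `G`-subrepresentation is an
`H`-subrepresentation with the same underlying subspace. [folklore] -/
theorem Representation.isIrreducible_of_isIrreducible_comp {H : Type*} [Group H] {V : Type*}
    [AddCommGroup V] [Module k V] (ρ : Representation k G V) (f : H →* G)
    (h : Representation.IsIrreducible (ρ.comp f)) : ρ.IsIrreducible := by
  haveI := h
  -- a `G`-subrepresentation restricts to an `H`-subrepresentation on the same subspace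
  have key : ∀ S : Subrepresentation ρ, ∃ S' : Subrepresentation (ρ.comp f),
      S'.toSubmodule = S.toSubmodule := fun S ↦
    ⟨⟨S.toSubmodule, fun x _ hv ↦ S.apply_mem_toSubmodule (f x) hv⟩, rfl⟩
  have hbot : (⊥ : Subrepresentation (ρ.comp f)).toSubmodule =
      (⊥ : Subrepresentation ρ).toSubmodule := rfl
  have htop : (⊤ : Subrepresentation (ρ.comp f)).toSubmodule =
      (⊤ : Subrepresentation ρ).toSubmodule := rfl
  haveI : Nontrivial (Subrepresentation ρ) := ⟨⟨⊥, ⊤, fun e ↦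
    (IsSimpleOrder.bot_ne_top (α := Subrepresentation (ρ.comp f)))
      (Subrepresentation.toSubmodule_injective
        (hbot.trans ((congrArg Subrepresentation.toSubmodule e).trans htop.symm)))⟩⟩
  refine ⟨fun S ↦ ?_⟩
  obtain ⟨S', hS'⟩ := key S
  rcases eq_bot_or_eq_top S' with h0 | h1
  · left
    exact Subrepresentation.toSubmodule_injective (hS'.symm.trans ((congrArg _ h0).trans hbot))
  · right
    exact Subrepresentation.toSubmodule_injective (hS'.symm.trans ((congrArg _ h1).trans htop))

/-- **A direct sum of two non-zero representations is reducible**: `V ⊕ 0` is a proper non-zero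
subrepresentation of `ρ ⊕ σ` (Mathlib `Representation.prod`). [folklore] -/
theorem Representation.not_isIrreducible_prod {V : Type*} {W : Type*} [AddCommGroup V]
    [Module k V] [AddCommGroup W] [Module k W] [Nontrivial V] [Nontrivial W]
    (ρ : Representation k G V) (σ : Representation k G W) : ¬ (ρ.prod σ).IsIrreducible := by
  intro h
  -- the subrepresentation `V ⊕ 0`
  let S : Subrepresentation (ρ.prod σ) :=
    ⟨(⊤ : Submodule k V).prod (⊥ : Submodule k W), fun g v hv ↦ by
      rw [Submodule.mem_prod, Submodule.mem_bot] at hv ⊢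
      rw [Representation.prod_apply_apply, hv.2, map_zero]
      exact ⟨Submodule.mem_top, rfl⟩⟩
  have hbot : (⊥ : Subrepresentation (ρ.prod σ)).toSubmodule = ⊥ := rfl
  have htop : (⊤ : Subrepresentation (ρ.prod σ)).toSubmodule = ⊤ := rfl
  obtain ⟨x, hx⟩ := exists_ne (0 : V)
  obtain ⟨y, hy⟩ := exists_ne (0 : W)
  rcases h.eq_bot_or_eq_top S with h0 | h1
  · have hmem : ((x, 0) : V × W) ∈ S.toSubmodule :=
      Submodule.mem_prod.mpr ⟨Submodule.mem_top, (Submodule.mem_bot k).mpr rfl⟩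
    rw [h0, hbot, Submodule.mem_bot, Prod.mk_eq_zero] at hmem
    exact hx hmem.1
  · have hmem : ((0, y) : V × W) ∈ (⊤ : Subrepresentation (ρ.prod σ)).toSubmodule := by
      rw [htop]; exact Submodule.mem_top
    rw [← h1] at hmem
    exact hy ((Submodule.mem_bot k).mp (Submodule.mem_prod.mp hmem).2)

/-! ### Characteristic polynomials detect irreducibility -/

/-- The `g`-component of the representation on `kⁿ` through `σ : G → GL_n(k)` is
`Matrix.toLin'` of the matrix `σ(g)`; hence its characteristic polynomial is `det(X - σ(g))`.
[folklore] -/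
theorem charpoly_ofDistribMulAction_comp_apply {n : ℕ} (σ : G →* GL (Fin n) k) (g : G) :
    (((Representation.ofDistribMulAction k (GL (Fin n) k) (Fin n → k)).comp σ) g).charpoly =
      ((σ g : GL (Fin n) k) : Matrix (Fin n) (Fin n) k).charpoly := by
  have e : (((Representation.ofDistribMulAction k (GL (Fin n) k) (Fin n → k)).comp σ) g :
      (Fin n → k) →ₗ[k] (Fin n → k)) =
        Matrix.toLin' ((σ g : GL (Fin n) k) : Matrix (Fin n) (Fin n) k) :=
    LinearMap.ext fun v ↦ by rw [Matrix.toLin'_apply]; rfl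
  rw [e, Matrix.charpoly_toLin']

/-- **A representation whose characteristic polynomials split off those of two representations
of positive rank is reducible.**  Let `σ : G → GL_n(k)`, `A : G → GL_m(k)`, `D : G → GL_p(k)` be
homomorphisms with `m, p > 0` and `det(X - σ(g)) = det(X - A(g)) · det(X - D(g))` for all `g`
(e.g. `σ` block upper triangular with diagonal blocks `A`, `D`, or any representation with the
characteristic polynomials of such).  Then the representation of `G` on `kⁿ` through `σ` is NOT
irreducible: otherwise it is semisimple with the characteristic polynomials of the semisimple
`A^{ss} ⊕ D^{ss}` (`exists_semisimplification`), hence equivalent to it by Brauer–Nesbitt over an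
arbitrary field (`Representation.nonempty_equiv_of_charpoly_eq`), but `A^{ss} ⊕ D^{ss}` is
reducible (`Representation.not_isIrreducible_prod`).
[cite: BourbakiAlgebreVIII2012, VIII § 20 n° 6, Thm. 2, Cor. 1 (p. 378)] -/
theorem not_isIrreducible_of_charpoly_eq_mul {n m p : ℕ} (hm : 0 < m) (hp : 0 < p)
    (σ : G →* GL (Fin n) k) (A : G →* GL (Fin m) k) (D : G →* GL (Fin p) k)
    (h : ∀ g, ((σ g : GL (Fin n) k) : Matrix (Fin n) (Fin n) k).charpoly =
      ((A g : GL (Fin m) k) : Matrix (Fin m) (Fin m) k).charpoly *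
        ((D g : GL (Fin p) k) : Matrix (Fin p) (Fin p) k).charpoly) :
    ¬ Representation.IsIrreducible
      ((Representation.ofDistribMulAction k (GL (Fin n) k) (Fin n → k)).comp σ) := by
  intro hirr
  obtain ⟨A', hA'ss, hA'cp, -⟩ := exists_semisimplification A
  obtain ⟨D', hD'ss, hD'cp, -⟩ := exists_semisimplification D
  set R : Representation k G (Fin n → k) :=
    (Representation.ofDistribMulAction k (GL (Fin n) k) (Fin n → k)).comp σ
  set ρA : Representation k G (Fin m → k) :=
    (Representation.ofDistribMulAction k (GL (Fin m) k) (Fin m → k)).comp A'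
  set ρD : Representation k G (Fin p → k) :=
    (Representation.ofDistribMulAction k (GL (Fin p) k) (Fin p → k)).comp D'
  haveI : ρA.IsSemisimpleRepresentation := hA'ss
  haveI : ρD.IsSemisimpleRepresentation := hD'ss
  haveI : IsSimpleOrder (Subrepresentation R) := hirr
  haveI : R.IsSemisimpleRepresentation :=
    (inferInstance : ComplementedLattice (Subrepresentation R))
  have hcp : ∀ g, (R g).charpoly = ((ρA.prod ρD) g).charpoly := fun g ↦ by
    rw [show (ρA.prod ρD) g = (ρA g).prodMap (ρD g) from rfl, LinearMap.charpoly_prodMap,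
      charpoly_ofDistribMulAction_comp_apply,
      charpoly_ofDistribMulAction_comp_apply, charpoly_ofDistribMulAction_comp_apply, h g, hA'cp,
      hD'cp]
  obtain ⟨e⟩ := Representation.nonempty_equiv_of_charpoly_eq R (ρA.prod ρD) hcp
  haveI : Nonempty (Fin m) := ⟨⟨0, hm⟩⟩
  haveI : Nonempty (Fin p) := ⟨⟨0, hp⟩⟩
  exact Representation.not_isIrreducible_prod ρA ρD (Representation.isIrreducible_of_equiv e)

/-- **Irreducibility is detected by characteristic polynomials.**  If `τ σ : G → GL_n(k)` have
the same characteristic polynomials and the representation on `kⁿ` through `σ` is irreducible,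
then so is the one through `τ`: a proper non-zero stable subspace for `τ` gives diagonal blocks
`A`, `D` of positive rank with `det(X - τ(g)) = det(X - A(g)) det(X - D(g))`
(`exists_blocks_of_subrepresentation`), contradicting `not_isIrreducible_of_charpoly_eq_mul` for
`σ`.  For residual Galois representations this is "a representation with irreducible
semisimplified reduction is residually irreducible" (Darmon–Diamond–Taylor 1995, §2.1).
[cite: BourbakiAlgebreVIII2012, VIII § 20 n° 6, Thm. 2, Cor. 1 (p. 378)] -/
theorem isIrreducible_of_charpoly_eq {n : ℕ} (τ σ : G →* GL (Fin n) k)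
    (h : ∀ g, ((τ g : GL (Fin n) k) : Matrix (Fin n) (Fin n) k).charpoly =
      ((σ g : GL (Fin n) k) : Matrix (Fin n) (Fin n) k).charpoly)
    (hσ : Representation.IsIrreducible
      ((Representation.ofDistribMulAction k (GL (Fin n) k) (Fin n → k)).comp σ)) :
    Representation.IsIrreducible
      ((Representation.ofDistribMulAction k (GL (Fin n) k) (Fin n → k)).comp τ) := by
  classical
  set T : Representation k G (Fin n → k) :=
    (Representation.ofDistribMulAction k (GL (Fin n) k) (Fin n → k)).comp τ
  haveI := hσ
  haveI : Nontrivial (Fin n → k) := Representation.nontrivial_of_isIrreducible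
    ((Representation.ofDistribMulAction k (GL (Fin n) k) (Fin n → k)).comp σ)
  have hbot : (⊥ : Subrepresentation T).toSubmodule = ⊥ := rfl
  have htop : (⊤ : Subrepresentation T).toSubmodule = ⊤ := rfl
  haveI : Nontrivial (Subrepresentation T) := ⟨⟨⊥, ⊤, fun e ↦ by
    have e' := congrArg Subrepresentation.toSubmodule e
    rw [hbot, htop] at e'
    exact bot_ne_top e'⟩⟩
  by_contra hτ
  obtain ⟨W, hW0, hW1⟩ : ∃ W : Subrepresentation T, W ≠ ⊥ ∧ W ≠ ⊤ := by
    by_contra hW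
    push Not at hW
    exact hτ ⟨fun W ↦ or_iff_not_imp_left.mpr (hW W)⟩
  obtain ⟨m, p, hmn, hpn, e, A, D, hcp, -, -⟩ := exists_blocks_of_subrepresentation τ W hW0 hW1
  have hmp : m + p = n := by simpa using Fintype.card_congr e
  exact not_isIrreducible_of_charpoly_eq_mul (by omega) (by omega) σ A D
    (fun g ↦ (h g).symm.trans (hcp g)) hσ

end Literature.RepresentationTheory.Semisimple
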